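import Mathlib
import HarnessLib

/-!
# Connectivity correlation inequalities for `φ_{w,q}` — the BERNSTEIN CRITERION for cell polynomials

Helper file (`--supports stmt-CriticalPhenomena-4575`), FK sub-lane `prim-bschramm-fk-3` (gen 9); builds on p205010 (kernel theorem, internal audit signed;
external expert review pending).  No named facts, no sorries, no definitions.

The exact certificates of fk-3 gen 9 (all hub cells of `K₅, K₆, K₇`, DOUBLE-WHEELS.md §10) and gen 6 (K₄, §10.3 of FK-BARRIER.md) certify `P(q) ≥ 0` on `[0,1]`
for an integer polynomial `P(q) = ∑_{e ≤ d} a_e q^e` by checking that its (scaled, integer) Bernstein coefficients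
`B̃_k = ∑_{e ≤ k} a_e · C(d-e, k-e)` (`k ≤ d`) are all `≥ 0`.  This file proves the criterion once and for all:
* `FK.pow_eq_sum_bernstein` — `q^e = ∑_{j ≤ d-e} C(d-e, j) q^{e+j} (1-q)^{d-e-j}` (`e ≤ d`; the binomial theorem for `(q + (1-q))^{d-e} = 1`);
* **`FK.sum_mul_pow_nonneg_of_bernstein`** — if `B̃_k ≥ 0` for all `k ≤ d` then `∑_{e ≤ d} a_e q^e ≥ 0` for every `q ∈ [0,1]`.
It is the analytic third of the kernel route 'hub cells ⇒ `HubCovBoundUnder`' (`FK.hubCovBoundUnder_of_hubCells_nonneg`, p257126; plan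
HOME/prim-bschramm-fk-3/K5-KERNEL-PLAN.md §5). [folklore]
-/

noncomputable section

namespace Summit.CriticalPhenomena.PercolationContinuityZ3.Theorems

namespace FK

open Finset

/-- **Monomials in the Bernstein basis.**  For `e ≤ d`: `q^e = ∑_{j ≤ d-e} C(d-e, j) · q^{e+j} · (1-q)^{d-e-j}` (binomial theorem applied to
`(q + (1-q))^{d-e} = 1`). [folklore] -/
theorem pow_eq_sum_bernstein (q : ℝ) {d e : ℕ} (_he : e ≤ d) :
    q ^ e = ∑ j ∈ range (d - e + 1), ((d - e).choose j : ℝ) * (q ^ (e + j) * (1 - q) ^ (d - e - j)) := by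
  have h1 : (q + (1 - q)) ^ (d - e) = 1 := by rw [add_sub_cancel, one_pow]
  have h2 := add_pow q (1 - q) (d - e)
  rw [h1] at h2
  calc q ^ e = q ^ e * 1 := (mul_one _).symm
    _ = q ^ e * ∑ j ∈ range (d - e + 1), q ^ j * (1 - q) ^ (d - e - j) * ((d - e).choose j : ℝ) := by rw [← h2]
    _ = ∑ j ∈ range (d - e + 1), ((d - e).choose j : ℝ) * (q ^ (e + j) * (1 - q) ^ (d - e - j)) := by
        rw [mul_sum]
        refine sum_congr rfl fun j _ => ?_
        rw [pow_add]; ring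

/-- **Bernstein criterion.**  If the scaled Bernstein coefficients `B̃_k = ∑_{e ≤ k} a_e C(d-e, k-e)`, `k ≤ d`, of `P(q) = ∑_{e ≤ d} a_e q^e` are all
non-negative, then `P(q) ≥ 0` for every `q ∈ [0,1]`.  (`P = ∑_k B̃_k q^k (1-q)^{d-k}` after exchanging the order of summation.) [folklore] -/
theorem sum_mul_pow_nonneg_of_bernstein {d : ℕ} {a : ℕ → ℝ}
    (h : ∀ k ≤ d, 0 ≤ ∑ e ∈ range (k + 1), a e * ((d - e).choose (k - e) : ℝ))
    {q : ℝ} (h0 : 0 ≤ q) (h1 : q ≤ 1) :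
    0 ≤ ∑ e ∈ range (d + 1), a e * q ^ e := by
  -- expand every monomial in the Bernstein basis
  have hexp : ∑ e ∈ range (d + 1), a e * q ^ e =
      ∑ e ∈ range (d + 1), ∑ j ∈ range (d - e + 1), a e * ((d - e).choose j : ℝ) * (q ^ (e + j) * (1 - q) ^ (d - e - j)) := by
    refine sum_congr rfl fun e he => ?_
    rw [pow_eq_sum_bernstein q (Nat.lt_succ_iff.1 (mem_range.1 he)), mul_sum]
    exact sum_congr rfl fun j _ => by ring
  -- exchange the order of summation: (e, j) ↦ (k, e) with k = e + j
  have hswap : ∑ e ∈ range (d + 1), ∑ j ∈ range (d - e + 1), a e * ((d - e).choose j : ℝ) * (q ^ (e + j) * (1 - q) ^ (d - e - j)) =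
      ∑ k ∈ range (d + 1), ∑ e ∈ range (k + 1), a e * ((d - e).choose (k - e) : ℝ) * (q ^ k * (1 - q) ^ (d - k)) := by
    rw [sum_sigma', sum_sigma']
    refine sum_nbij' (fun p => ⟨p.1 + p.2, p.1⟩) (fun p => ⟨p.2, p.1 - p.2⟩) ?_ ?_ ?_ ?_ ?_
    · rintro ⟨e, j⟩ hp
      simp only [mem_sigma, mem_range] at hp ⊢
      omega
    · rintro ⟨k, e⟩ hp
      simp only [mem_sigma, mem_range] at hp ⊢
      omega
    · rintro ⟨e, j⟩ hp
      simp only [mem_sigma, mem_range] at hp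
      ext <;> simp
    · rintro ⟨k, e⟩ hp
      simp only [mem_sigma, mem_range] at hp
      ext <;> simp
      omega
    · rintro ⟨e, j⟩ hp
      simp only [mem_sigma, mem_range] at hp
      have hk : e + j - e = j := by omega
      have hd : d - (e + j) = d - e - j := by omega
      simp only [hk, hd]
  rw [hexp, hswap]
  refine sum_nonneg fun k hk => ?_
  have hk' : k ≤ d := Nat.lt_succ_iff.1 (mem_range.1 hk)
  have hfac : ∑ e ∈ range (k + 1), a e * ((d - e).choose (k - e) : ℝ) * (q ^ k * (1 - q) ^ (d - k)) =
      (∑ e ∈ range (k + 1), a e * ((d - e).choose (k - e) : ℝ)) * (q ^ k * (1 - q) ^ (d - k)) := by rw [sum_mul]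
  rw [hfac]
  exact mul_nonneg (h k hk') (mul_nonneg (pow_nonneg h0 _) (pow_nonneg (sub_nonneg.2 h1) _))

end FK

end Summit.CriticalPhenomena.PercolationContinuityZ3.Theorems
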